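import Mathlib
import HarnessLib
import Summits.HubbardSuperconductivity.HubbardSuperconductivity.Theorems.KLProgrammeKLRegimeEngineWPlainLinePatterns
import Summits.HubbardSuperconductivity.HubbardSuperconductivity.Theorems.KLProgrammeKLRegimeEngineWPlainLineFromMomentumRepresentation
import Summits.HubbardSuperconductivity.HubbardSuperconductivity.Theorems.KLProgrammeKLRegimeEngineV17F2RowBOfE1Data3

/-!
# Route `KLProgramme` — crux K3 ENGINE (stmt-HubbardSuperconductivity-20437 `KLRegimeEngineV17F2`), registration V2 (α1) image 27cd7ed0f55f17c0,
# ROW (b) `stub_engine_step_norms` (digest e78dfb33d2f7), binder #6 `hplainE1` BY TYPE, step 2: the U-currency `klScaleWt_n`-weighted PLAIN quartic line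
# family of `𝒱ₙ[Kₙ]` FROM ONE MOMENTUM-SPACE PAIR-TRANSFER REPRESENTATION of the `↑↓` Cooper channel («TV → pinned-sum conversion», E1-LEDGER §1 #6),
# and the row-(b) capstone from `{hE₁, hmomRep, hincr}` (cell gate-hubbard-kl, seat p3 g25)

(T7w) `TorusFourierL2.wplainFourLegLine_of_momentumRepresentation` (k3c2-p3 g17) turns a representation of the degree-4 MOMENTUM kernel of a Grassmann element
on the charge string `(+,+,−,−)`, spins `σ`, as a finite superposition of conserving transfer bumps plus a remainder into the weighted plain four-leg line AT THAT
LABEL STRING, every pinned leg.  The `hplainE1` binder of `A24a1G14.stub_engine_step_norms_of_E1data₃` (p3 g24) asks the line of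
`𝒱ₙ[Kₙ] = klEffectiveAction … (klFlowFrameU … n) klE0 n` at EVERY label string `τ′ : Fin 4 → SectorLeg 1` (leg `0`).  Step 1 (`…EngineWPlainLinePatterns`, this
seat) reduced every string to the ONE Cooper pattern `(ψ⁺↑, ψ⁺↓, ψ⁻↑, ψ⁻↓)` at every pin (factor `2`; exact symmetries of `𝒱ₙ[K]` only).  Here:

* §5 **`wplainLine_klEffectiveAction_allStrings_of_momentumRepresentation`** — any frame `K`, any `e₀, n`, weight scale `j`: the (T7w) hypotheses VERBATIM at
  `σ = (0,1,0,1)` for `𝒱ₙ[K]` ⟹ `∀ τ q y, ε³·Σ_{x : x q = y} klScaleWt_j(pos x)·‖W_τ(x)‖ ≤ 2·(ε³·2(‖κ‖(2M·L²)²)·√(6561988608·n₀)·(2M·L²)·Σ‖a_i‖A_i + r)`;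
* §6 **`wplainLineFamily_klEng_of_momRepFamily`** — under EXACTLY `E4FlowAt`'s binders (no osc rows), a momentum-representation family `hmomRep` (ℕ-indexed
  bumps with (T1w) data at rates `≥ (Λₙβ/(2M), Λₙ)`, dyadic total variation `Σ‖amp_i‖A_i`, weighted remainder `r`, closure
  `2·(… ) ≤ klE0·(a·|U| + bfun·(Klam·U)²)`) ⟹ the `hplainE1` family VERBATIM; and the capstone
  **`A24a1G14.stub_engine_step_norms_of_E1data₄ hE₁ ha hb hu₀ hmomRep hincr`** ⊢ row (b) verbatim (one application of `…_of_E1data₃`).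
So after this file row (b)'s binder #6 is, BY NAME, the pair-transfer momentum representation of the `↑↓` quartic kernel of `𝒱ₙ[Kₙ]` with a U-currency dyadic
total variation and a U²-currency weighted remainder — the value-side object of `KLRegimeSplit.quarticValueAllScales_of_edgeClauses_explicit` (k3c1) read
through (T1w)/(T2w)/(T7w); what E1 owes for #6 is that representation (the sign-resolved Cooper running) and the remainder's weighted line.
Everything is proved; no definitions; nothing asserts `hmomRep`, `hE₁`, `hincr`, row (b), any stub of 20437, K3, U₀, the window or superconductivity.
References: BGM 2006 §2.1 (1)–(3), §2.3 (2.17), (2.41a), §2.5–§2.8 (2.52)–(2.84), Lemma 2.5 (2.98), §3 (3.2)–(3.8) [cite: BenfattoGiulianiMastropietro2006].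
-/

noncomputable section

namespace Summit.HubbardSuperconductivity.HubbardSuperconductivity.Theorems.EngineV8

set_option linter.dupNamespace false -- summit = problem name (single-conjunct summit), D-0017

open Classical
open Real Finset Complex Literature.MathematicalPhysics.QuantumLattice Literature.Probability.LatticeModels GrassmannAlgebra
open Summit.HubbardSuperconductivity.HubbardSuperconductivity.Theorems.KLProgrammeLegKernels
open Summit.HubbardSuperconductivity.HubbardSuperconductivity.Theorems.KLRegimeSplit
open Summit.HubbardSuperconductivity.HubbardSuperconductivity.Theorems.KLRegimeWick

variable {L M : ℕ} [NeZero L] [NeZero M]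

/-! ## §5 The weighted plain four-leg line of `𝒱ₙ[K]` at EVERY label string from ONE momentum-space pair-transfer representation of the `↑↓` channel -/

section Engine

open Summit.HubbardSuperconductivity.HubbardSuperconductivity.Theorems.TorusFourierL2

/-- **THE `klScaleWt_j`-WEIGHTED PLAIN FOUR-LEG LINE OF `𝒱ₙ[K]` AT EVERY LABEL STRING AND EVERY PIN, FROM ONE MOMENTUM-SPACE REPRESENTATION** of the degree-4
momentum kernel of `𝒱ₙ[K] = klEffectiveAction … K e₀ n` on the Cooper pattern `(ψ⁺↑, ψ⁺↓, ψ⁻↑, ψ⁻↓)` (spins `(0,1,0,1)`, charges `(0,0,1,1)`) as a finite superposition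
of CONSERVING TRANSFER BUMPS plus a remainder — the hypotheses of (T7w) `wplainFourLegLine_of_momentumRepresentation` VERBATIM at `σ = (0,1,0,1)` (bump data at rates
`(s₀ⁱ, s₁ⁱ)` dominating the weight's `(Λ_jβ/(2M), Λ_j)`, sizes `A_i`, supports, time/axis third differences, weighted remainder pinned sums `≤ r`):
`∀ τ q y, ε³·Σ_{x : x q = y} klScaleWt_j(pos x)·‖W_τ(x)‖ ≤ 2·(ε³·2(‖κ‖(2M·L²)²)·√(6561988608·n₀)·(2M·L²)·Σ_i ‖a_i‖A_i + r)` — (T7w) at the Cooper pattern, then §4.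
[cite: BenfattoGiulianiMastropietro2006, §2.1 (1)-(3), §2.3 (2.17), §2.8 (2.81)] -/
theorem wplainLine_klEffectiveAction_allStrings_of_momentumRepresentation {ι : Type*} {β : ℝ} (hβ : 0 < β) (U μ : ℝ) (K : TrigPolyC4v) (e₀ : ℝ)
    (n : ℕ) (S : Finset ι) (a : ι → ℂ) (κ : ℂ) (G : ι → TorusSite 1 (2 * M) × TorusSite 2 L → ℂ) (ρ : (Fin 4 → FreqMomentum L M) → ℂ)
    (hker : ∀ k : Fin 4 → FreqMomentum L M,
      kernel ℂ (klEffectiveAction L M β U μ K e₀ n) 4 (fun i => ((k i, (![0, 1, 0, 1] : Fin 4 → Fin 2) i), (![0, 0, 1, 1] : Fin 4 → Fin 2) i)) =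
        ∑ i ∈ S, a i * (κ * (if ((fun _ : Fin 1 => ((((k 0).1 : ℕ) : ZMod (2 * M)))), (k 0).2) + ((fun _ : Fin 1 => ((((k 1).1 : ℕ) : ZMod (2 * M)))), (k 1).2) = (((fun _ : Fin 1 => ((((k 2).1 : ℕ) : ZMod (2 * M)))), (k 2).2) : TorusSite 1 (2 * M) × TorusSite 2 L) + ((fun _ : Fin 1 => ((((k 3).1 : ℕ) : ZMod (2 * M)))), (k 3).2) then (fun Q => G i (-Q)) (((fun _ : Fin 1 => ((((k 0).1 : ℕ) : ZMod (2 * M)))), (k 0).2) + ((fun _ : Fin 1 => ((((k 1).1 : ℕ) : ZMod (2 * M)))), (k 1).2)) else 0)) + ρ k)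
    (s₀ s₁ A : ι → ℝ) (Ns : ι → ℕ) {n₀ r : ℝ} (hn₀ : 0 ≤ n₀)
    (hs₀ : ∀ i ∈ S, 0 < s₀ i) (hs₀1 : ∀ i ∈ S, s₀ i ≤ 1) (hs₁ : ∀ i ∈ S, 0 < s₁ i) (hs₁1 : ∀ i ∈ S, s₁ i ≤ 1)
    (hA : ∀ i ∈ S, 0 ≤ A i) (hNs : ∀ i ∈ S, (Ns i : ℝ) ≤ n₀ * (s₀ i * (2 * M : ℕ)) * (s₁ i * L) ^ 2)
    (hsupp : ∀ i ∈ S, (univ.filter fun q => G i q ≠ 0).card ≤ Ns i) (hsup : ∀ i ∈ S, ∀ q, ‖G i q‖ ≤ A i)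
    (h₀ : ∀ i ∈ S, ∀ q, ‖(fwdDiff ((fun _ : Fin 1 => (1 : ZMod (2 * M))), (0 : TorusSite 2 L)))^[3] (G i) q‖ ≤
      A i * (4 / (s₀ i * (2 * M : ℕ))) ^ 3)
    (h₁ : ∀ i ∈ S, ∀ q (j : Fin 2), ‖(fwdDiff ((0 : TorusSite 1 (2 * M)), (Pi.single j (1 : ZMod L) : TorusSite 2 L)))^[3] (G i) q‖ ≤
      A i * (4 / (s₁ i * L)) ^ 3)
    (j : ℕ) (hts₀ : ∀ i ∈ S, klScale klE0 j * β / (2 * M) ≤ s₀ i) (hts₁ : ∀ i ∈ S, klScale klE0 j ≤ s₁ i)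
    (hr : ∀ (q : Fin 4) (y : SpaceTimeIdx L M), imagTimeWeight β M ^ 3 *
      ∑ x ∈ univ.filter (fun x : Fin 4 → SpaceTimeIdx L M => x q = y),
        klScaleWt L M β j ((univ.image x).image (fun x : SpaceTimeIdx L M => (((((2 * (x.1 : ℕ) : ℕ)) : ZMod (2 * (2 * M)))), x.2))) *
          ‖(fun (Ω : Fin 4 → SectorLeg 1) (x : Fin 4 → SpaceTimeIdx L M) =>
            ∑ k : Fin 4 → FreqMomentum L M, (∏ i, trivialMultiplier L M (Ω i).1.1 (k i) * hubbardPlaneWave L M β (Ω i).2 (k i) (x i)) * ρ k)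
            (fun i : Fin 4 => ((((0 : Fin 1), (![0, 1, 0, 1] : Fin 4 → Fin 2) i) : Fin 1 × Fin 2), (![0, 0, 1, 1] : Fin 4 → Fin 2) i)) x‖ ≤ r)
    (τ : Fin 4 → SectorLeg 1) (q : Fin 4) (y : SpaceTimeIdx L M) :
    imagTimeWeight β M ^ 3 *
        ∑ x ∈ univ.filter (fun x : Fin 4 → SpaceTimeIdx L M => x q = y),
          klScaleWt L M β j ((univ.image x).image (fun x : SpaceTimeIdx L M => (((((2 * (x.1 : ℕ) : ℕ)) : ZMod (2 * (2 * M)))), x.2))) *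
            ‖sectorisedKernel L M β (trivialMultiplier L M) (klEffectiveAction L M β U μ K e₀ n) 4 τ x‖ ≤
      2 * (imagTimeWeight β M ^ 3 * (2 * (‖κ‖ * ((((2 * M : ℕ) : ℝ) * (L : ℝ) ^ 2) ^ 2)) * (Real.sqrt (6561988608 * n₀) * (((2 * M : ℕ) : ℝ) * (L : ℝ) ^ 2))) *
        ∑ i ∈ S, ‖a i‖ * A i + r) := by
  -- (T7w) at the Cooper pattern, every pin
  have hT7 := wplainFourLegLine_of_momentumRepresentation hβ (klEffectiveAction L M β U μ K e₀ n) (![0, 1, 0, 1] : Fin 4 → Fin 2) S a κ G ρ hker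
    s₀ s₁ A Ns hn₀ hs₀ hs₀1 hs₁ hs₁1 hA hNs hsupp hsup h₀ h₁ j hts₀ hts₁ hr
  -- the weight is leg-symmetric and nonnegative
  set w : (Fin 4 → SpaceTimeIdx L M) → ℝ := fun x =>
    klScaleWt L M β j ((univ.image x).image (fun x : SpaceTimeIdx L M => (((((2 * (x.1 : ℕ) : ℕ)) : ZMod (2 * (2 * M)))), x.2))) with hwdef
  have hw : ∀ (σ : Equiv.Perm (Fin 4)) (x : Fin 4 → SpaceTimeIdx L M), w (x ∘ σ) = w x := by
    intro σ x
    simp only [hwdef]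
    rw [← Finset.image_image (f := (σ : Fin 4 → Fin 4)) (g := x), Finset.image_univ_equiv]
  have hw0 : ∀ x, 0 ≤ w x := fun x => zero_le_one.trans (one_le_klScaleWt L M β j _)
  have hε : 0 ≤ imagTimeWeight β M ^ 3 := pow_nonneg (imagTimeWeight_nonneg hβ.le M) 3
  have hS0 : 0 ≤ imagTimeWeight β M ^ 3 * (2 * (‖κ‖ * ((((2 * M : ℕ) : ℝ) * (L : ℝ) ^ 2) ^ 2)) *
      (Real.sqrt (6561988608 * n₀) * (((2 * M : ℕ) : ℝ) * (L : ℝ) ^ 2))) * ∑ i ∈ S, ‖a i‖ * A i + r := by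
    refine le_trans ?_ (hT7 q y)
    exact mul_nonneg hε (sum_nonneg fun x _ => mul_nonneg (hw0 x) (norm_nonneg _))
  refine wpinSum_klEffectiveAction_le_two_mul_of_cooperPattern β (trivialMultiplier L M) U μ K e₀ n w hw hw0 hε hS0 (fun ω q' y' => ?_) τ q y
  have hω : ω = fun _ => 0 := funext fun i => Fin.eq_zero (ω i)
  subst hω
  exact hT7 q' y'

end Engine

/-! ## §6 ROW (b) binder `hplainE1` BY TYPE: the U-currency weighted plain quartic line family of `𝒱ₙ[Kₙ]` from a MOMENTUM-REPRESENTATION family, and the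
row-(b) capstone from `{hE₁, hmomRep, hincr}` -/

section Face

open Summit.HubbardSuperconductivity.HubbardSuperconductivity.Theorems.DispersionFlow

/-- **`hplainE1` FROM A MOMENTUM-REPRESENTATION FAMILY** (the «TV → pinned-sum conversion» of E1-LEDGER §1 #6, by type): if under EXACTLY the binders of
`E4FlowAt` (`G P R Q cc`-doors, `μ ∈ klWindowC`, `0 < U ≤ u₀ G P R Q cc`, β-window, `klEngL₃/M₃`, `1 ≤ n ≤ n_β + 1`, `IsKLRegime`, `HistP`, `FrameOK … Kₙ`; no osc rows)
the degree-4 momentum kernel of `𝒱ₙ[Kₙ] = klEffectiveAction … (klFlowFrameU … n) klE0 n` on the Cooper pattern `(ψ⁺↑, ψ⁺↓, ψ⁻↑, ψ⁻↓)` is a finite superposition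
`Σ_{i∈S} amp_i·κ·[k̄₀+k̄₁ = k̄₂+k̄₃]·bump_i(−(k̄₀+k̄₁)) + ρ` of CONSERVING TRANSFER BUMPS (ℕ-indexed: the scales) with (T1w) data at rates `(s₀ⁱ, s₁ⁱ) ≥ (Λₙβ/(2M), Λₙ)`,
dyadic total variation `Σ‖amp_i‖A_i`, `klScaleWt_n`-weighted remainder pinned sums `≤ r`, closing into the U-currency budget as
`2·(ε³·2(‖κ‖(2M·L²)²)·√(6561988608·n₀)·(2M·L²)·Σ‖amp_i‖A_i + r) ≤ klE0·(a·|U| + bfun·(Klam·U)²)`, THEN the `hplainE1` family of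
`A24a1G14.stub_engine_step_norms_of_E1data₃` holds VERBATIM (every label string `τ′`, leg `0`, every pin). [cite: BenfattoGiulianiMastropietro2006, §2.3 (2.17), §2.8 (2.81), (2.41a)] -/
theorem wplainLineFamily_klEng_of_momRepFamily {a : ℝ} {bfun u₀ : GeoConsts → SplitConsts → RenConsts → EngConsts → ℝ → ℝ}
    (hmomRep : ∀ (G : GeoConsts), G.WF → ∀ (P : SplitConsts) (R : RenConsts) (Q : EngConsts) (cc : ℝ), P.WF → R.WF2 → Q.WF → 0 < cc →
      cc ≤ klEngC₃6 P R → ∀ μ ∈ klWindowC, ∀ U : ℝ, 0 < U → U ≤ u₀ G P R Q cc →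
      ∀ β : ℝ, klBetaMin ≤ β → β ≤ Real.exp (cc / U ^ 2) →
      ∀ (L M : ℕ) [NeZero L] [NeZero M], klEngL₃ β U ≤ L → klEngM₃ β U L ≤ M →
      ∀ n : ℕ, 1 ≤ n → n ≤ nScales β + 1 → IsKLRegime U cc (-(n : ℤ)) →
        HistP klPredsV17F2 L M G P Q R β U μ 0 n → FrameOK R U (nScales β) μ (klFlowFrameU L M β U μ n) →
        ∃ (S : Finset ℕ) (amp : ℕ → ℂ) (κ : ℂ) (bump : ℕ → TorusSite 1 (2 * M) × TorusSite 2 L → ℂ) (ρ : (Fin 4 → FreqMomentum L M) → ℂ)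
          (s₀ s₁ A : ℕ → ℝ) (Ns : ℕ → ℕ) (n₀ r : ℝ), 0 ≤ n₀ ∧
          (∀ k : Fin 4 → FreqMomentum L M,
            kernel ℂ (klEffectiveAction L M β U μ (klFlowFrameU L M β U μ n) klE0 n) 4
                (fun i => ((k i, (![0, 1, 0, 1] : Fin 4 → Fin 2) i), (![0, 0, 1, 1] : Fin 4 → Fin 2) i)) =
              ∑ i ∈ S, amp i * (κ * (if ((fun _ : Fin 1 => ((((k 0).1 : ℕ) : ZMod (2 * M)))), (k 0).2) + ((fun _ : Fin 1 => ((((k 1).1 : ℕ) : ZMod (2 * M)))), (k 1).2) = (((fun _ : Fin 1 => ((((k 2).1 : ℕ) : ZMod (2 * M)))), (k 2).2) : TorusSite 1 (2 * M) × TorusSite 2 L) + ((fun _ : Fin 1 => ((((k 3).1 : ℕ) : ZMod (2 * M)))), (k 3).2) then (fun Q => bump i (-Q)) (((fun _ : Fin 1 => ((((k 0).1 : ℕ) : ZMod (2 * M)))), (k 0).2) + ((fun _ : Fin 1 => ((((k 1).1 : ℕ) : ZMod (2 * M)))), (k 1).2)) else 0)) + ρ k) ∧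
          (∀ i ∈ S, 0 < s₀ i) ∧ (∀ i ∈ S, s₀ i ≤ 1) ∧ (∀ i ∈ S, 0 < s₁ i) ∧ (∀ i ∈ S, s₁ i ≤ 1) ∧ (∀ i ∈ S, 0 ≤ A i) ∧
          (∀ i ∈ S, (Ns i : ℝ) ≤ n₀ * (s₀ i * (2 * M : ℕ)) * (s₁ i * L) ^ 2) ∧
          (∀ i ∈ S, (univ.filter fun q => bump i q ≠ 0).card ≤ Ns i) ∧ (∀ i ∈ S, ∀ q, ‖bump i q‖ ≤ A i) ∧
          (∀ i ∈ S, ∀ q, ‖(fwdDiff ((fun _ : Fin 1 => (1 : ZMod (2 * M))), (0 : TorusSite 2 L)))^[3] (bump i) q‖ ≤ A i * (4 / (s₀ i * (2 * M : ℕ))) ^ 3) ∧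
          (∀ i ∈ S, ∀ q (l : Fin 2), ‖(fwdDiff ((0 : TorusSite 1 (2 * M)), (Pi.single l (1 : ZMod L) : TorusSite 2 L)))^[3] (bump i) q‖ ≤
            A i * (4 / (s₁ i * L)) ^ 3) ∧
          (∀ i ∈ S, klScale klE0 n * β / (2 * M) ≤ s₀ i) ∧ (∀ i ∈ S, klScale klE0 n ≤ s₁ i) ∧
          (∀ (q : Fin 4) (y : SpaceTimeIdx L M), imagTimeWeight β M ^ 3 *
            ∑ x ∈ univ.filter (fun x : Fin 4 → SpaceTimeIdx L M => x q = y),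
              klScaleWt L M β n ((univ.image x).image (fun x : SpaceTimeIdx L M => (((((2 * (x.1 : ℕ) : ℕ)) : ZMod (2 * (2 * M)))), x.2))) *
                ‖(fun (Ω : Fin 4 → SectorLeg 1) (x : Fin 4 → SpaceTimeIdx L M) =>
                  ∑ k : Fin 4 → FreqMomentum L M, (∏ i, trivialMultiplier L M (Ω i).1.1 (k i) * hubbardPlaneWave L M β (Ω i).2 (k i) (x i)) * ρ k)
                  (fun i : Fin 4 => ((((0 : Fin 1), (![0, 1, 0, 1] : Fin 4 → Fin 2) i) : Fin 1 × Fin 2), (![0, 0, 1, 1] : Fin 4 → Fin 2) i)) x‖ ≤ r) ∧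
          2 * (imagTimeWeight β M ^ 3 * (2 * (‖κ‖ * ((((2 * M : ℕ) : ℝ) * (L : ℝ) ^ 2) ^ 2)) *
                (Real.sqrt (6561988608 * n₀) * (((2 * M : ℕ) : ℝ) * (L : ℝ) ^ 2))) * ∑ i ∈ S, ‖amp i‖ * A i + r) ≤
            klE0 * (a * |U| + bfun G P R Q cc * (P.Klam * U) ^ 2)) :
    ∀ (G : GeoConsts), G.WF → ∀ (P : SplitConsts) (R : RenConsts) (Q : EngConsts) (cc : ℝ), P.WF → R.WF2 → Q.WF → 0 < cc →
      cc ≤ klEngC₃6 P R → ∀ μ ∈ klWindowC, ∀ U : ℝ, 0 < U → U ≤ u₀ G P R Q cc →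
      ∀ β : ℝ, klBetaMin ≤ β → β ≤ Real.exp (cc / U ^ 2) →
      ∀ (L M : ℕ) [NeZero L] [NeZero M], klEngL₃ β U ≤ L → klEngM₃ β U L ≤ M →
      ∀ n : ℕ, 1 ≤ n → n ≤ nScales β + 1 → IsKLRegime U cc (-(n : ℤ)) →
        HistP klPredsV17F2 L M G P Q R β U μ 0 n → FrameOK R U (nScales β) μ (klFlowFrameU L M β U μ n) →
        ∀ (τ' : Fin 4 → SectorLeg 1) (y : SpaceTimeIdx L M),
          imagTimeWeight β M ^ 3 * ∑ x' ∈ univ.filter (fun x' : Fin 4 → SpaceTimeIdx L M => x' 0 = y),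
            klScaleWt L M β n ((univ.image x').image (fun x : SpaceTimeIdx L M => (((((2 * (x.1 : ℕ) : ℕ)) : ZMod (2 * (2 * M)))), x.2))) *
              ‖sectorisedKernel L M β (trivialMultiplier L M)
                (klEffectiveAction L M β U μ (klFlowFrameU L M β U μ n) klE0 n) 4 τ' x'‖ ≤
          klE0 * (a * |U| + bfun G P R Q cc * (P.Klam * U) ^ 2) := by
  intro G hG P R Q cc hP hR hQ hcc hcc6 μ hμ U hU hUu β hβ hβc L M _ _ hL hM n hn1 hn hreg hhist hfr τ' y
  obtain ⟨S, amp, κ, bump, ρ, s₀, s₁, A, Ns, n₀, r, hn₀, hker, hs₀, hs₀1, hs₁, hs₁1, hA, hNs, hsupp, hsup, h₀, h₁, hts₀, hts₁, hr, hclose⟩ :=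
    hmomRep G hG P R Q cc hP hR hQ hcc hcc6 μ hμ U hU hUu β hβ hβc L M hL hM n hn1 hn hreg hhist hfr
  have hβ0 : 0 < β := KLRegimeSplit.pos_of_klBetaMin_le hβ
  exact (wplainLine_klEffectiveAction_allStrings_of_momentumRepresentation hβ0 U μ (klFlowFrameU L M β U μ n) klE0 n S amp κ bump ρ hker
    s₀ s₁ A Ns hn₀ hs₀ hs₀1 hs₁ hs₁1 hA hNs hsupp hsup h₀ h₁ n hts₀ hts₁ hr τ' 0 y).trans hclose

end Face

end Summit.HubbardSuperconductivity.HubbardSuperconductivity.Theorems.EngineV8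

namespace Summit.HubbardSuperconductivity.HubbardSuperconductivity.Theorems.EngineV8.A24a1G14

set_option linter.dupNamespace false -- summit = problem name (single-conjunct summit), D-0017

open Classical
open Real Finset Literature.MathematicalPhysics.QuantumLattice Literature.Probability.LatticeModels GrassmannAlgebra
open Literature.MathematicalPhysics.QuantumLattice.FermiRG
open Summit.HubbardSuperconductivity.HubbardSuperconductivity.Theorems.KLProgrammeLegKernels
open Summit.HubbardSuperconductivity.HubbardSuperconductivity.Theorems.KLRegimeSplit
open Summit.HubbardSuperconductivity.HubbardSuperconductivity.Theorems.DispersionFlow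
open Summit.HubbardSuperconductivity.HubbardSuperconductivity.Theorems.EngineV8

/-- **ROW (b) (digest e78dfb33d2f7) FROM `{hE₁, hmomRep, hincr}`** — the E1-class data of `stub_engine_step_norms_of_E1data₃` with its U-currency weighted plain
quartic line family `hplainE1` REPLACED by the momentum-representation family `hmomRep` of `wplainLineFamily_klEng_of_momRepFamily` (pair-transfer bumps of the
`↑↓` Cooper channel + dyadic total variation + weighted remainder, one pattern, every pin); one application of `stub_engine_step_norms_of_E1data₃`.
Nothing here asserts any of the three hypothesis families, row (b), any stub of 20437, K3, U₀, the window or superconductivity.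
[cite: BenfattoGiulianiMastropietro2006, §2.3 (2.17), §2.5-§2.8 (2.52)-(2.84), (2.41a), Lemma 2.5 (2.98), §3 (3.2)-(3.8)] -/
theorem stub_engine_step_norms_of_E1data₄
    (hE₁ : ∀ (P : SplitConsts) (R : RenConsts), P.WF → R.WF2 →
      ∃ s₂u s₂c s₄ S₆ : ℝ, 0 ≤ s₂u ∧ 0 ≤ s₂c ∧ 0 ≤ s₄ ∧ 0 ≤ S₆ ∧ ∃ cE UE : ℝ, 0 < cE ∧ 0 < UE ∧
      ∀ (Q : EngConsts) (cc : ℝ), 0 < cc → cc ≤ klEngC₃6 P R → cc ≤ cE →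
      ∀ μ ∈ klWindowC, ∀ U : ℝ, 0 < U → U ≤ klEngU₀10 P R cc → U ≤ UE →
      ∀ β : ℝ, klBetaMin ≤ β → β ≤ Real.exp (cc / U ^ 2) →
      ∀ (L M : ℕ) [NeZero L] [NeZero M], klEngL₄ P R β U ≤ L → klEngM₃ β U L ≤ M →
      ∀ n : ℕ, 1 ≤ n → n ≤ nScales β + 1 → IsKLRegime U cc (-(n : ℤ)) →
      HistP klPredsV17F2 L M klEngGeo14 P Q R β U μ 0 n →
      (∀ m, 1 ≤ m → m < n → FlowPieceOscAt L M (klReadOscC P R) β U μ m) →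
      FrameOK R U (nScales β) μ (klFlowFrameU L M β U μ n) →
      (∀ j ≤ n, LevelsUExportMixedAt L M (klCU2 P R (klEngQ7 P R)) P β U μ j) →
      (∀ i, 1 ≤ i → i ≤ n → ∀ (q : Fin 2) (w : SpaceTimeIdx L M × SectorLeg (sectorCount (i - 1))),
        klWtPinnedSumOf L M β μ (klFlowFrameU L M β U μ n) (i - 1) 2 (klEffectiveAction L M β U μ (klFlowFrameU L M β U μ n) klE0 i) q w ≤
          (s₂u * |U| + s₂c * cc) * ((4 : ℝ) ^ (i - 1))⁻¹) ∧
      (∀ i, 1 ≤ i → i ≤ n → ∀ (q : Fin 4) (τ' : Fin 4 → SectorLeg 1) (y' : SpaceTimeIdx L M),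
        imagTimeWeight β M ^ 3 * ∑ x' ∈ univ.filter (fun x' : Fin 4 → SpaceTimeIdx L M => x' q = y'),
          klScaleWt L M β i ((univ.image x').image (fun x : SpaceTimeIdx L M => (((((2 * (x.1 : ℕ) : ℕ)) : ZMod (2 * (2 * M)))), x.2))) *
            ‖sectorisedKernel L M β (trivialMultiplier L M) (klEffectiveAction L M β U μ (klFlowFrameU L M β U μ n) klE0 i) 4 τ' x'‖ ≤ s₄ * epsCoupling P U i) ∧
      (∀ i, 1 ≤ i → i ≤ n → ∀ (q : Fin 6) (w : SpaceTimeIdx L M × SectorLeg (sectorCount (i - 1))),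
        klWtPinnedSumOf L M β μ (klFlowFrameU L M β U μ n) (i - 1) 6 (klEffectiveAction L M β U μ (klFlowFrameU L M β U μ n) klE0 i) q w ≤
          S₆ * epsCoupling P U i ^ 2 * (2 : ℝ) ^ (4 * i)))
    {a : ℝ} (ha : 0 ≤ a) {bfun u₀ : GeoConsts → SplitConsts → RenConsts → EngConsts → ℝ → ℝ}
    (hb : ∀ G P R Q cc, 0 ≤ bfun G P R Q cc) (hu₀ : ∀ G P R Q cc, 0 < u₀ G P R Q cc)
    (hmomRep : ∀ (G : GeoConsts), G.WF → ∀ (P : SplitConsts) (R : RenConsts) (Q : EngConsts) (cc : ℝ), P.WF → R.WF2 → Q.WF → 0 < cc →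
      cc ≤ klEngC₃6 P R → ∀ μ ∈ klWindowC, ∀ U : ℝ, 0 < U → U ≤ u₀ G P R Q cc →
      ∀ β : ℝ, klBetaMin ≤ β → β ≤ Real.exp (cc / U ^ 2) →
      ∀ (L M : ℕ) [NeZero L] [NeZero M], klEngL₃ β U ≤ L → klEngM₃ β U L ≤ M →
      ∀ n : ℕ, 1 ≤ n → n ≤ nScales β + 1 → IsKLRegime U cc (-(n : ℤ)) →
        HistP klPredsV17F2 L M G P Q R β U μ 0 n → FrameOK R U (nScales β) μ (klFlowFrameU L M β U μ n) →
        ∃ (S : Finset ℕ) (amp : ℕ → ℂ) (κ : ℂ) (bump : ℕ → TorusSite 1 (2 * M) × TorusSite 2 L → ℂ) (ρ : (Fin 4 → FreqMomentum L M) → ℂ)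
          (s₀ s₁ A : ℕ → ℝ) (Ns : ℕ → ℕ) (n₀ r : ℝ), 0 ≤ n₀ ∧
          (∀ k : Fin 4 → FreqMomentum L M,
            kernel ℂ (klEffectiveAction L M β U μ (klFlowFrameU L M β U μ n) klE0 n) 4
                (fun i => ((k i, (![0, 1, 0, 1] : Fin 4 → Fin 2) i), (![0, 0, 1, 1] : Fin 4 → Fin 2) i)) =
              ∑ i ∈ S, amp i * (κ * (if ((fun _ : Fin 1 => ((((k 0).1 : ℕ) : ZMod (2 * M)))), (k 0).2) + ((fun _ : Fin 1 => ((((k 1).1 : ℕ) : ZMod (2 * M)))), (k 1).2) = (((fun _ : Fin 1 => ((((k 2).1 : ℕ) : ZMod (2 * M)))), (k 2).2) : TorusSite 1 (2 * M) × TorusSite 2 L) + ((fun _ : Fin 1 => ((((k 3).1 : ℕ) : ZMod (2 * M)))), (k 3).2) then (fun Q => bump i (-Q)) (((fun _ : Fin 1 => ((((k 0).1 : ℕ) : ZMod (2 * M)))), (k 0).2) + ((fun _ : Fin 1 => ((((k 1).1 : ℕ) : ZMod (2 * M)))), (k 1).2)) else 0)) + ρ k) ∧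
          (∀ i ∈ S, 0 < s₀ i) ∧ (∀ i ∈ S, s₀ i ≤ 1) ∧ (∀ i ∈ S, 0 < s₁ i) ∧ (∀ i ∈ S, s₁ i ≤ 1) ∧ (∀ i ∈ S, 0 ≤ A i) ∧
          (∀ i ∈ S, (Ns i : ℝ) ≤ n₀ * (s₀ i * (2 * M : ℕ)) * (s₁ i * L) ^ 2) ∧
          (∀ i ∈ S, (univ.filter fun q => bump i q ≠ 0).card ≤ Ns i) ∧ (∀ i ∈ S, ∀ q, ‖bump i q‖ ≤ A i) ∧
          (∀ i ∈ S, ∀ q, ‖(fwdDiff ((fun _ : Fin 1 => (1 : ZMod (2 * M))), (0 : TorusSite 2 L)))^[3] (bump i) q‖ ≤ A i * (4 / (s₀ i * (2 * M : ℕ))) ^ 3) ∧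
          (∀ i ∈ S, ∀ q (l : Fin 2), ‖(fwdDiff ((0 : TorusSite 1 (2 * M)), (Pi.single l (1 : ZMod L) : TorusSite 2 L)))^[3] (bump i) q‖ ≤
            A i * (4 / (s₁ i * L)) ^ 3) ∧
          (∀ i ∈ S, klScale klE0 n * β / (2 * M) ≤ s₀ i) ∧ (∀ i ∈ S, klScale klE0 n ≤ s₁ i) ∧
          (∀ (q : Fin 4) (y : SpaceTimeIdx L M), imagTimeWeight β M ^ 3 *
            ∑ x ∈ univ.filter (fun x : Fin 4 → SpaceTimeIdx L M => x q = y),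
              klScaleWt L M β n ((univ.image x).image (fun x : SpaceTimeIdx L M => (((((2 * (x.1 : ℕ) : ℕ)) : ZMod (2 * (2 * M)))), x.2))) *
                ‖(fun (Ω : Fin 4 → SectorLeg 1) (x : Fin 4 → SpaceTimeIdx L M) =>
                  ∑ k : Fin 4 → FreqMomentum L M, (∏ i, trivialMultiplier L M (Ω i).1.1 (k i) * hubbardPlaneWave L M β (Ω i).2 (k i) (x i)) * ρ k)
                  (fun i : Fin 4 => ((((0 : Fin 1), (![0, 1, 0, 1] : Fin 4 → Fin 2) i) : Fin 1 × Fin 2), (![0, 0, 1, 1] : Fin 4 → Fin 2) i)) x‖ ≤ r) ∧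
          2 * (imagTimeWeight β M ^ 3 * (2 * (‖κ‖ * ((((2 * M : ℕ) : ℝ) * (L : ℝ) ^ 2) ^ 2)) *
                (Real.sqrt (6561988608 * n₀) * (((2 * M : ℕ) : ℝ) * (L : ℝ) ^ 2))) * ∑ i ∈ S, ‖amp i‖ * A i + r) ≤
            klE0 * (a * |U| + bfun G P R Q cc * (P.Klam * U) ^ 2))
    (hincr : ∀ (P : SplitConsts) (R : RenConsts), P.WF → R.WF2 →
      ∃ Bw : ℝ, 0 ≤ Bw ∧ ∃ uI : EngConsts → ℝ → ℝ, (∀ Q cc, 0 < uI Q cc) ∧ ∃ cI : ℝ, 0 < cI ∧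
      ∀ Q : EngConsts, (klEngQ7 P R).IsRaiseOf Q →
      ∀ cc : ℝ, 0 < cc → cc ≤ klEngC₃6 P R → cc ≤ cI →
      ∀ μ ∈ klWindowC, ∀ U : ℝ, 0 < U → U ≤ klEngU₀10 P R cc → U ≤ uI Q cc →
      ∀ β : ℝ, klBetaMin ≤ β → β ≤ Real.exp (cc / U ^ 2) →
      ∀ (L M : ℕ) [NeZero L] [NeZero M], klEngL₄ P R β U ≤ L → klEngM₃ β U L ≤ M →
      ∀ n : ℕ, 1 ≤ n → n ≤ nScales β + 1 →
        HistP klPredsV17F2 L M klEngGeo14 P Q R β U μ 0 n → FrameOK R U (nScales β) μ (klFlowFrameU L M β U μ n) →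
        ∃ b : ℕ → ℝ, (∑ j ∈ range n, (klScale klE0 (j + 1))⁻¹ * b j ≤ Bw) ∧
          ∀ j < n, ∀ w : GridLeg (GridPoint L (2 * (2 * M))),
            ∑ Y ∈ univ.filter (fun Y : Fin 2 → GridLeg (GridPoint L (2 * (2 * M))) => Y 0 = w),
              klScaleWt L M β (j + 1) ((univ.image Y).image gridLegPos) *
                ‖kernel ℂ
                  (effAction ℂ ((hubbardGridSub L M β (2 * (2 * M))).transpose *
                      hubbardCovAboveCT L M β μ 0 (klFlowFrameU L M β U μ n) (klScale klE0 (j + 1)) * hubbardGridSub L M β (2 * (2 * M)))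
                    (hubbardGridInteraction L (2 * (2 * M)) β U + hubbardGridCounterQuadratic L (2 * (2 * M)) β (klFlowFrameU L M β U μ n)) -
                  effAction ℂ ((hubbardGridSub L M β (2 * (2 * M))).transpose *
                      hubbardCovAboveCT L M β μ 0 (klFlowFrameU L M β U μ n) (klScale klE0 j) * hubbardGridSub L M β (2 * (2 * M)))
                    (hubbardGridInteraction L (2 * (2 * M)) β U + hubbardGridCounterQuadratic L (2 * (2 * M)) β (klFlowFrameU L M β U μ n))) 2 Y‖ ≤
              b j * U ^ 2 * (β / (2 * ((2 * (2 * M) : ℕ) : ℝ)))) :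
    ∀ (P : SplitConsts) (R : RenConsts) (c : ℝ), P.WF → R.WF2 → 0 < c → c ≤ klEngC₃7GU klEngGeo14 P R →
      ∀ μ ∈ klWindowC, ∀ U : ℝ, 0 < U → U ≤ klEngU₀12GQ klEngGeo14 (klEngQ9dG klEngGeo14 P R) P R c → ∀ β : ℝ, klBetaMin ≤ β → β ≤ Real.exp (c / U ^ 2) →
        ∀ (L M : ℕ) [NeZero L] [NeZero M], klEngL₄ P R β U ≤ L → klEngM₃ β U L ≤ M →
          ∀ n : ℕ, 1 ≤ n → n ≤ nScales β + 1 → IsKLRegime U c (-(n : ℤ)) →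
            HistP klPredsV17F2 L M klEngGeo14 P (klEngQ9dG klEngGeo14 P R) R β U μ 0 n →
              (∀ m, 1 ≤ m → m < n → FlowPieceOscAt L M (klReadOscC P R) β U μ m) →
              FrameOK R U (nScales β) μ (klFlowFrameU L M β U μ n) →
                (∀ j ≤ n, LevelsUExportMixedAt L M (klCU2 P R (klEngQ7 P R)) P β U μ j) →
                  KernelNormsV4 L M P (klEngQ9dG klEngGeo14 P R) β U μ (klFlowFrameU L M β U μ n) n ∧
                    (∀ j ≤ n, (KernelNormsLevels L M P (klEngQ9dG klEngGeo14 P R) β U μ (klFlowFrameU L M β U μ n) j ∧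
                      KernelNormsWt4 L M (klWtBudget P (klEngQ9dG klEngGeo14 P R) U j) β U μ (klFlowFrameU L M β U μ n) j)) ∧
                    EngineFirstMoments L M klEngGeo14 P (klEngQ9dG klEngGeo14 P R) β U μ (klFlowFrameU L M β U μ n) n ∧
                    IsoFirstMomentsAt L M klIsoMomC (klIsoMomD P R) P β U μ n ∧
                    TwoLegGridFlowMomentsAtC L M (klZtG klEngGeo14 P R) (klZs1G klEngGeo14 P R) (klZs2G klEngGeo14 P R) c β U μ n  :=
  stub_engine_step_norms_of_E1data₃ hE₁ ha hb hu₀ (wplainLineFamily_klEng_of_momRepFamily hmomRep) hincr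

end Summit.HubbardSuperconductivity.HubbardSuperconductivity.Theorems.EngineV8.A24a1G14

end
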